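import Mathlib
import Summits.Ventures.PercRepro2.Defs
import Summits.Ventures.PercRepro2.Independence
import Summits.Ventures.PercRepro2.Harris
import Summits.Ventures.PercRepro2.Graph
import Summits.Ventures.PercRepro2.Events
import Summits.Ventures.PercRepro2.ZCClusterBlind
import Summits.Ventures.PercRepro2.ZCRootDecomp

/-!
# Conditional probability given the edges away from `a₁` (blind cell PercRepro2, mine-a g28)

Write `F` for the edges not at `a₁` (`awayEdges`).  For an event `A` let `condProb p F A ω` be the
probability of `A` given the configuration of `F` (the edges outside `F` re-randomised).  The
**fibrewise product rule** (`expect_indicator_mul_eq_condProb_mul`): if over every configuration of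
`F` the events `A` and `B` are determined by disjoint sets of edges outside `F`, then
`E[1_A · 1_B] = E[condProb A · 1_B]`.  Also the bookkeeping of glued configurations for `G − a₁`:
`deleteVertex` of a glued configuration only sees the first component (`deleteVertex_glue`), and the
open neighbours of `a₁` are read off the second (`mem_openNbr_glue_iff`).  Used by `ZCThetaPA`.
-/

namespace Summit.Ventures.PercRepro2

variable {V : Type*} {E : Type*} [Fintype V] [DecidableEq V] [Fintype E] [DecidableEq E]
  {R : Type*} [CommRing R] [LinearOrder R] [IsStrictOrderedRing R]

/-! ## Conditional probability given the edges of a set `F` -/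

section CondProb

variable (p : E → R) (F : Set E) [DecidablePred (· ∈ F)]

/-- The restriction of a configuration to the edges of `F`. -/
def restrictTo (ω : Config E) : {e // e ∈ F} → Bool := fun i => ω i

omit [Fintype V] [DecidableEq V] [Fintype E] [DecidableEq E] [LinearOrder R] [IsStrictOrderedRing R] in
/-- `restrictTo F` recovers the first component of a glued configuration. -/
lemma restrictTo_glue (σ₁ : {e // e ∈ F} → Bool) (σ₂ : {e // e ∉ F} → Bool) :
    restrictTo F (glue F σ₁ σ₂) = σ₁ := by
  funext i
  exact glue_apply_of_mem F σ₁ σ₂ i.2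

/-- The probability of `A` given the edges of `F` (the edges outside `F` re-randomised). -/
noncomputable def condProb (A : Set (Config E)) (ω : Config E) : R :=
  ∑ σ₂ : {e // e ∉ F} → Bool,
    weight (fun i : {e // e ∉ F} => p i) σ₂ * A.indicator 1 (glue F (restrictTo F ω) σ₂)

omit [Fintype V] [DecidableEq V] [LinearOrder R] [IsStrictOrderedRing R] in
/-- `condProb A` at a glued configuration is the probability of the fibre of `A` over `σ₁`. -/
lemma condProb_glue (A : Set (Config E)) (σ₁ : {e // e ∈ F} → Bool)
    (σ₂ : {e // e ∉ F} → Bool) :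
    condProb p F A (glue F σ₁ σ₂) =
      prob (fun i : {e // e ∉ F} => p i) {τ | glue F σ₁ τ ∈ A} := by
  unfold condProb prob
  rw [restrictTo_glue]
  refine Finset.sum_congr rfl fun τ _ => ?_
  by_cases h : glue F σ₁ τ ∈ A <;> simp [h]

omit [Fintype V] [DecidableEq V] [LinearOrder R] [IsStrictOrderedRing R] in
/-- **Fibrewise product rule**: if over every configuration of `F` the events `A` and `B` are
determined by disjoint sets of edges outside `F`, then `E[1_A · 1_B] = E[condProb A · 1_B]`. -/
theorem expect_indicator_mul_eq_condProb_mul (A B : Set (Config E))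
    (h : ∀ σ₁ : {e // e ∈ F} → Bool, ∃ F₁ F₂ : Set {e // e ∉ F}, Disjoint F₁ F₂ ∧
      DependsOn (fun σ₂ => glue F σ₁ σ₂ ∈ A) F₁ ∧ DependsOn (fun σ₂ => glue F σ₁ σ₂ ∈ B) F₂) :
    expect p (fun ω => A.indicator 1 ω * B.indicator 1 ω) =
      expect p (fun ω => condProb p F A ω * B.indicator 1 ω) := by
  rw [expect_eq_sum_glue p _ F, expect_eq_sum_glue p _ F]
  refine Finset.sum_congr rfl fun σ₁ _ => ?_
  obtain ⟨F₁, F₂, hdisj, hA, hB⟩ := h σ₁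
  set p₂ : {e // e ∉ F} → R := fun i => p i
  have hAB : prob p₂ ({τ | glue F σ₁ τ ∈ A} ∩ {τ | glue F σ₁ τ ∈ B}) =
      prob p₂ {τ | glue F σ₁ τ ∈ A} * prob p₂ {τ | glue F σ₁ τ ∈ B} :=
    prob_inter_eq_mul_of_dependsOn p₂ hdisj hA hB
  -- left side: `w₁ · P₂(A_σ₁ ∩ B_σ₁)`
  have hL : ∑ σ₂ : {e // e ∉ F} → Bool, weight (fun i : {e // e ∈ F} => p i) σ₁ * weight p₂ σ₂ *
      (A.indicator 1 (glue F σ₁ σ₂) * B.indicator 1 (glue F σ₁ σ₂)) =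
      weight (fun i : {e // e ∈ F} => p i) σ₁ *
        prob p₂ ({τ | glue F σ₁ τ ∈ A} ∩ {τ | glue F σ₁ τ ∈ B}) := by
    unfold prob
    rw [Finset.mul_sum]
    refine Finset.sum_congr rfl fun σ₂ _ => ?_
    by_cases hA' : glue F σ₁ σ₂ ∈ A <;> by_cases hB' : glue F σ₁ σ₂ ∈ B <;>
      simp [hA', hB', p₂]
  -- right side: `w₁ · P₂(A_σ₁) · P₂(B_σ₁)`
  have hR : ∑ σ₂ : {e // e ∉ F} → Bool, weight (fun i : {e // e ∈ F} => p i) σ₁ * weight p₂ σ₂ *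
      (condProb p F A (glue F σ₁ σ₂) * B.indicator 1 (glue F σ₁ σ₂)) =
      weight (fun i : {e // e ∈ F} => p i) σ₁ *
        (prob p₂ {τ | glue F σ₁ τ ∈ A} * prob p₂ {τ | glue F σ₁ τ ∈ B}) := by
    have hc : ∀ σ₂, condProb p F A (glue F σ₁ σ₂) = prob p₂ {τ | glue F σ₁ τ ∈ A} :=
      fun σ₂ => condProb_glue p F A σ₁ σ₂
    simp_rw [hc]
    rw [show prob p₂ {τ | glue F σ₁ τ ∈ B} = ∑ σ₂ : {e // e ∉ F} → Bool,
        weight p₂ σ₂ * B.indicator 1 (glue F σ₁ σ₂) by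
      unfold prob
      refine Finset.sum_congr rfl fun σ₂ _ => ?_
      by_cases hB' : glue F σ₁ σ₂ ∈ B <;> simp [hB']]
    rw [Finset.mul_sum, Finset.mul_sum]
    refine Finset.sum_congr rfl fun σ₂ _ => ?_
    ring
  rw [hL, hR, hAB]

end CondProb

/-! ## The edges of `a₁` and the cluster-blind event -/

section Fibres

variable (ends : E → Sym2 V) (a₁ : V)

/-- The edges not at `a₁`. -/
abbrev awayEdges : Set E := (touches ends (↑({a₁} : Finset V) : Set V))ᶜ

omit [Fintype E] [DecidableEq E] in
/-- `deleteVertex` is the restriction to the edges away from `a₁`. -/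
lemma deleteVertex_eq_restrict (ω : Config E) :
    deleteVertex ends a₁ ω = restrict (awayEdges ends a₁) ω := rfl

omit [Fintype E] [DecidableEq E] in
/-- `deleteVertex` of a glued configuration only sees the first component. -/
lemma deleteVertex_glue (σ₁ : {e // e ∈ awayEdges ends a₁} → Bool)
    (σ₂ : {e // e ∉ awayEdges ends a₁} → Bool) :
    deleteVertex ends a₁ (glue (awayEdges ends a₁) σ₁ σ₂) =
      glue (awayEdges ends a₁) σ₁ (fun _ => false) := by
  funext e
  rw [deleteVertex_eq_restrict]
  by_cases he : e ∈ awayEdges ends a₁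
  · rw [restrict_apply_of_mem he, glue_apply_of_mem _ _ _ he, glue_apply_of_mem _ _ _ he]
  · rw [restrict_apply_of_notMem he, glue_apply_of_notMem (awayEdges ends a₁) σ₁ (fun _ => false) he]

omit [Fintype V] [DecidableEq V] [Fintype E] [DecidableEq E] in
/-- An edge at `a₁` with other endpoint `v` is not an away edge. -/
lemma not_mem_awayEdges_of_ends {e : E} {v : V} (h : ends e = s(a₁, v)) :
    e ∉ awayEdges ends a₁ := by
  intro he
  exact he (mem_touches_of_ends h (Or.inl (by simp)))

omit [Fintype E] [DecidableEq E] in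
/-- Open neighbours of `a₁` in a glued configuration are read off the second component. -/
lemma mem_openNbr_glue_iff (σ₁ : {e // e ∈ awayEdges ends a₁} → Bool)
    (σ₂ : {e // e ∉ awayEdges ends a₁} → Bool) (v : V) :
    v ∈ openNbr ends (glue (awayEdges ends a₁) σ₁ σ₂) a₁ ↔
      ∃ e : {e // e ∉ awayEdges ends a₁}, σ₂ e = true ∧ ends e = s(a₁, v) := by
  constructor
  · rintro ⟨e, he, hends⟩
    have hne : e ∉ awayEdges ends a₁ := not_mem_awayEdges_of_ends ends a₁ hends
    refine ⟨⟨e, hne⟩, ?_, hends⟩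
    rwa [glue_apply_of_notMem _ _ _ hne] at he
  · rintro ⟨⟨e, hne⟩, he, hends⟩
    exact ⟨e, by rw [glue_apply_of_notMem _ _ _ hne]; exact he, hends⟩

end Fibres

end Summit.Ventures.PercRepro2
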